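import Summits.ABC.IUTFork.Cor312TeamAHonestCensusNodes
import Summits.ABC.IUTFork.Cor312VolumesRealAssembly
import HarnessLib

/-!
# [IUTchIII] Cor. 3.12 — the honest node census AT THE ASSEMBLED REAL (Dupuy–Hilado-level) SETTING

Record-only, proof-only companion (D-0012) of `Cor312TeamAHonestCensus{,Nodes}.lean` (p418084 / p418650,
abc-iut-w4-d021) at abc-iut-c312-5's real situation `Thm311.Real.situationDHVol` (Cor312VolumesRealAssembly.lean: the
situation of Thm. 3.11 over the real Dupuy–Hilado-level log-shells `logShellsDH X logv` with the VERBATIM all-places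
volume container `summandPiecesDH`) — the «real-model» census line of plan/ADJUDICATION-SPEC.md §2 (U)/(G):
WHICH Steps of the printed proof hold, in the kernel, for a `Cor312.Setting` over the assembled real situation.
S. Mochizuki, *Inter-universal Teichmüller theory III*, Cor. 3.12 proof pp. 174–186 [cite: Mochizuki2012, III Cor 3.12
pp.174–186]; claim key DISPUTED. TAKES NO SIDE; typed ≠ proved.

At `situationDHVol` three of the node-side inputs of the honest census are THEOREMS of the tree (c312-5 + Team B's
summand criterion): (Ind1)(Ind2) admissibility transport and B's `LogvolInvariant`
(`SummandPieces.adm_iff_and_logvolInvariant_of_generators` fed with `realizes_situationDHVol` +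
`generatorsPreserve_summandPiecesDH`) and monotone log-volume at ALL labels (`SummandPieces.logvol_mono_of_realizes`).
Hence:

* `holds_DHVol_of_ne_xi_f` — for EVERY `Cor312.Setting P` over `situationDHVol`, NINETEEN of the twenty nodes
  (all `s ≠ xi_f`) hold under the honest reading from exactly: the Kummer-(a) clause of the chosen column
  (`C.KummerA`, = typed Thm 3.11 (ii)(a) — the log-Kummer input Team B also names), the strip-isomorphism slot
  (fillable: `hNE_satisfiable`), `ThetaFinite` (the A-0 residual of `bridgeHyps_DH`) and `|log(q)| > 0`;
* `xi_f_holds_DHVol_iff_statement` — node (xi-f) at the real setting holds IFF the Corollary's `Statement`;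
* `honest_chain_DHVol_iff_gapGlobal` — the whole chain at the real setting holds IFF the gap.

GRANULARITY NOTE (w4-d062 N1, adopted): of the nineteen non-gap nodes, the eleven pre-(x) narrative nodes (opening
paragraph, Steps (i)–(ix)) hold because their observation slots are typed `True` / `Nonempty (LinkGluing P)` under
row A-5's no-inflation rule — their mathematical content enters through the loci, not through observation slots; the
CONTENT nodes (x), (xi-a)–(xi-e), (xi-g), (xi-h), (xii) hold with their real readings. So the adjudication's
G-LOCALISED sentence holds verbatim AT THE ASSEMBLED REAL DH-LEVEL SETTING, with the volume-side
inputs of Step (x) discharged by the real container rather than assumed (modulo the analyticity of `logv`,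
`LogvAnalytic`, discharged for `Real.analyticLogv` by `logvAnalytic_analyticLogv`, and the archimedean convention
recorded in Cor312VolumesRealAssembly). Residual inputs named, not hidden: Kummer-(a) of the column, `ThetaFinite`,
`AbsLogQPos`, THE GAP. [cite: DupuyHilado2025, §4.7–4.9]
-/

noncomputable section

namespace Summit.ABC

namespace IUTFork

namespace Cor312Proof

open Locus Obs Thm311 Thm311.Real Cor312 Cor312Vol StepXI Literature.IUT.LogThetaLattice Literature.IUT.LogVolume

variable {F : Type} [Field F] [NumberField F] (X : PilotData F) {logv : PadicLogs F} (hlog : LogvAnalytic logv)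
  (M : Type) [Field M] [NumberField M]
  (archPk : ∀ (j : (thetaIndex X).Label) (vQ : (thetaIndex X).VQ), Set ((logShellsDH X logv).Packet j vQ))
  (archSub : ∀ (j : (thetaIndex X).Label) (v : (thetaIndex X).V),
    Set ((logShellsDH X logv).Packet j ((thetaIndex X).over v)))
  (Ψ : ℤ → ∀ v : (thetaIndex X).V, v ∈ (thetaIndex X).Vbad → Set ((logShellsDH X logv).StarPacket v))
  (act : ℤ → ∀ v : (thetaIndex X).V, v ∈ (thetaIndex X).Vbad →
    (logShellsDH X logv).StarPacket v → Module.End ℚ ((logShellsDH X logv).StarPacket v))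
  (Mmod : ℤ → ∀ j : (thetaIndex X).LabelStar, Set ((logShellsDH X logv).GlobalPacket j.1))
  (region : ℤ → ∀ j : (thetaIndex X).LabelStar, FinDivisor M → ∀ vQ : (thetaIndex X).VQ,
    Set ((logShellsDH X logv).Packet j.1 vQ))
  (P : Cor312.Setting (situationDHVol X hlog M archPk archSub Ψ act Mmod region))

/-- **Step (x)'s volume-side inputs are THEOREMS at the assembled real DH-level setting**: (Ind1)(Ind2)
admissibility transport, B's `LogvolInvariant`, and monotone log-volume at all labels, for the line data of
`situationDHVol` ([IUTchIII] proof of Cor. 3.12, Step (x), p. 181 l. 5–13; Dupuy–Hilado §4.9). [claim: Mochizuki2012, status: disputed] -/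
theorem stepX_inputs_DHVol :
    (∀ Φ ∈ (logShellsDH X logv).Ind1Family ∪ (logShellsDH X logv).Ind2Family,
        ∀ (j : (thetaIndex X).Label) (vQ : (thetaIndex X).VQ) (A : Set ((logShellsDH X logv).Packet j vQ)),
        ((situationDHVol X hlog M archPk archSub Ψ act Mmod region).D P.n).Adm j vQ A ↔
          ((situationDHVol X hlog M archPk archSub Ψ act Mmod region).D P.n).Adm j vQ (Φ j vQ '' A)) ∧
    ((situationDHVol X hlog M archPk archSub Ψ act Mmod region).D P.n).LogvolInvariant ∧
    (∀ (j : (thetaIndex X).Label) (vQ : (thetaIndex X).VQ) (A B : Set ((logShellsDH X logv).Packet j vQ)),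
        ((situationDHVol X hlog M archPk archSub Ψ act Mmod region).D P.n).Adm j vQ A →
        ((situationDHVol X hlog M archPk archSub Ψ act Mmod region).D P.n).Adm j vQ B → A ⊆ B →
          ((situationDHVol X hlog M archPk archSub Ψ act Mmod region).D P.n).logvol j vQ A ≤
            ((situationDHVol X hlog M archPk archSub Ψ act Mmod region).D P.n).logvol j vQ B) := by
  have hreal := realizes_situationDHVol X hlog M archPk archSub Ψ act Mmod region P.n
  have h := SummandPieces.adm_iff_and_logvolInvariant_of_generators hreal (generatorsPreserve_summandPiecesDH X hlog)
  exact ⟨h.1, h.2, fun _ _ _ _ hA hB hAB => SummandPieces.logvol_mono_of_realizes _ hreal hA hB hAB⟩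

/-- **NINETEEN NODES HOLD AT THE ASSEMBLED REAL DH-LEVEL SETTING** (every `s ≠ xi_f`, for every `Cor312.Setting` over
`situationDHVol`, under the honest reading), from exactly: the Kummer-(a) clause of the chosen column `C` (typed
Thm 3.11 (ii)(a)), the strip-isomorphism slot `hNE` (fillable, `hNE_satisfiable`), `ThetaFinite`, `|log(q)| > 0` — the
(Ind1)(Ind2) volume inputs of Step (x) being discharged by `stepX_inputs_DHVol`. [claim: Mochizuki2012, status: disputed] -/
theorem holds_DHVol_of_ne_xi_f (C : Column (logShellsDH X logv))
    (hKumA : C.KummerA ((situationDHVol X hlog M archPk archSub Ψ act Mmod region).D P.n))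
    (D : ThetaLinkStrips P.LogLink P.Strip)
    (hNE : ∀ n m : ℤ, Nonempty (P.IsoS (D.stripLGP (P.lattice.logLink n (m - 1)))
      (D.stripDelta (P.lattice.theater (n + 1) m))))
    (L : Locus → Prop) (A : InputStrip.StripAlgorithm P) (hfin : P.ThetaFinite) (hq : P.AbsLogQPos)
    (s : Step) (hs : s ≠ .xi_f) : s.Holds L (honestReading P C D L A) :=
  have h := stepX_inputs_DHVol X hlog M archPk archSub Ψ act Mmod region P
  holds_honest_of_ne_xi_f C D L A h.1 h.2.1 h.2.2 hKumA hNE hfin hq s hs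

/-- **At the assembled real setting node (xi-f) holds IFF the Corollary's own `Statement`** (for any column, strips,
loci, strip algorithm; given `ThetaFinite ∧ AbsLogQPos`). [claim: Mochizuki2012, status: disputed] -/
theorem xi_f_holds_DHVol_iff_statement (C : Column (logShellsDH X logv)) (D : ThetaLinkStrips P.LogLink P.Strip)
    (L : Locus → Prop) (A : InputStrip.StripAlgorithm P) (hfin : P.ThetaFinite) (hq : P.AbsLogQPos) :
    Step.xi_f.Holds L (honestReading P C D L A) ↔ P.Statement :=
  xi_f_holds_honest_iff_statement C D L A hfin hq

/-- **At the assembled real setting the whole twenty-node chain holds IFF the gap** (given the Kummer-(a) clause of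
the column, the strip slot, `ThetaFinite`, `|log(q)| > 0`). [claim: Mochizuki2012, status: disputed] -/
theorem honest_chain_DHVol_iff_gapGlobal (C : Column (logShellsDH X logv))
    (hKumA : C.KummerA ((situationDHVol X hlog M archPk archSub Ψ act Mmod region).D P.n))
    (D : ThetaLinkStrips P.LogLink P.Strip)
    (hNE : ∀ n m : ℤ, Nonempty (P.IsoS (D.stripLGP (P.lattice.logLink n (m - 1)))
      (D.stripDelta (P.lattice.theater (n + 1) m))))
    (L : Locus → Prop) (A : InputStrip.StripAlgorithm P) (hfin : P.ThetaFinite) (hq : P.AbsLogQPos) :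
    Chain L (honestReading P C D L A) ↔ A.GapGlobal :=
  have h := stepX_inputs_DHVol X hlog M archPk archSub Ψ act Mmod region P
  honest_chain_iff_gapGlobal C D L A h.1 h.2.1 h.2.2 hKumA hNE hfin hq

/-- **END-TO-END at the assembled real setting**: bridge hypotheses (c312-5 `bridgeHyps_DH` supplies them from the
four finiteness residuals) + Kummer-(a) of the column + loci + strip slot + `|log(q)| > 0` + THE GAP ⊢ `Statement`
— factoring, as everywhere, through the gap alone (`StripAlgorithm.statement_of_gapGlobal`); recorded for the
census shape. [claim: Mochizuki2012, status: disputed] -/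
theorem teamA_statement_honest_DHVol (H : BridgeHyps P) (C : Column (logShellsDH X logv))
    (hKumA : C.KummerA ((situationDHVol X hlog M archPk archSub Ψ act Mmod region).D P.n))
    (D : ThetaLinkStrips P.LogLink P.Strip) {L : Locus → Prop} (hL : ∀ c, L c) (A : InputStrip.StripAlgorithm P)
    (hNE : ∀ n m : ℤ, Nonempty (P.IsoS (D.stripLGP (P.lattice.logLink n (m - 1)))
      (D.stripDelta (P.lattice.theater (n + 1) m))))
    (hq : P.AbsLogQPos) (hgap : A.GapGlobal) : P.Statement :=
  have h := stepX_inputs_DHVol X hlog M archPk archSub Ψ act Mmod region P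
  teamA_statement_honest H C D hL A h.1 h.2.1 h.2.2 hKumA hNE hq hgap

end Cor312Proof

end IUTFork

end Summit.ABC

end
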